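import Mathlib.Analysis.SpecialFunctions.Trigonometric.DerivHyp
import Literature.NumberTheory.LFunctions.ZetaZerosProofs
import Literature.NumberTheory.LFunctions.ZetaRealAxis
import Literature.NumberTheory.LFunctions.GeneralizedRH

/-!
# Stub `stub_riemannHypothesis_of_offLineMoment` of the line `Sketch` of the crux `SignCone.OscCoherentCore`
(item stmt-RiemannHypothesis-18013, route route-RiemannHypothesis-SignCone)

Honesty check for the off-line defect ledger (line `Sketch`): the line reduces the crux at every cutoff
`a > 13/10` to ONE terminal statement, the WINDOWED OFF-LINE SECOND-MOMENT LAW — for every height `t` and every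
finite set `S` of zeros `ρ` of `ζ` with `0 ≤ Re ρ ≤ 1`, `Im ρ ≠ 0`, `|Im ρ - t| ≤ 1/a`,

  `Σ_{ρ ∈ S} m(ρ) (Re ρ - 1/2)² ≤ κ(a)`,  `κ(a) = 1 / (400 (2a+1)³ cosh(a + 1/2) (a + 1))`

(`m = riemannZetaZeroOrder`, the multiplicity of the zero). This file proves that the law, taken over ALL
cutoffs `a > 13/10`, implies Mathlib's `RiemannHypothesis`
(`stub_riemannHypothesis_of_offLineMoment`); together with the vacuous converse under RH recorded in the
skeleton of the line, the terminal stub is therefore RH-equivalent — exactly as hard as the crux, no easier.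

Proof. Let `ζ(s) = 0` with `s` not a trivial zero and `s ≠ 1`. A zero with `Re s ≤ 0` is trivial
(`riemannZeta_eq_zero_iff_of_re_nonpos`) and `ζ ≠ 0` on `Re s ≥ 1` (Mathlib `riemannZeta_ne_zero_of_one_le_re`),
so `0 < Re s < 1`, whence `Im s ≠ 0` (`im_ne_zero_of_riemannZeta_eq_zero`: no real zeros in the open strip)
and `m(s) ≥ 1` (`riemannZetaZeroOrder_pos_iff`). The law at height `t = Im s` with `S = {s}` gives
`(Re s - 1/2)² ≤ m(s) (Re s - 1/2)² ≤ κ(a) ≤ 1/a` for every `a > 13/10` (`cosh ≥ 1`, `(2a+1)³ ≥ 1`,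
`offLineMomentConst_le_one_div`); letting `a → ∞`, `(Re s - 1/2)² ≤ 0`, i.e. `Re s = 1/2`.
Elementary; nothing beyond the cited tree lemmas is used. Deliberately NOT here: any attempt on the law itself
(it is RH-strength).
-/

noncomputable section

-- `Summit.RiemannHypothesis.RiemannHypothesis.…` repeats a namespace component by design (D-0017 layout).
set_option linter.dupNamespace false

open Complex MeasureTheory Set Filter
open scoped BigOperators Real Topology

namespace Summit.RiemannHypothesis.RiemannHypothesis.Theorems.OscCoherentCore

open Literature.NumberTheory.LFunctions

/-- The window constant is at most `1/a`: `κ(a) = 1/(400 (2a+1)³ cosh(a + 1/2) (a + 1)) ≤ 1/a` for `a > 0`,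
since `(2a+1)³ ≥ 1`, `cosh ≥ 1` and `a ≤ a + 1`. [folklore] -/
theorem offLineMomentConst_le_one_div {a : ℝ} (ha : 0 < a) :
    1 / (400 * (2 * a + 1) ^ 3 * Real.cosh (a + 1 / 2) * (a + 1)) ≤ 1 / a := by
  have hX : (1 : ℝ) ≤ (2 * a + 1) ^ 3 := one_le_pow₀ (by linarith)
  have hY : (1 : ℝ) ≤ Real.cosh (a + 1 / 2) := Real.one_le_cosh _
  have hP : (1 : ℝ) ≤ 400 * (2 * a + 1) ^ 3 * Real.cosh (a + 1 / 2) :=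
    calc (1 : ℝ) ≤ 400 * 1 * 1 := by norm_num
      _ ≤ 400 * (2 * a + 1) ^ 3 * Real.cosh (a + 1 / 2) := by gcongr
  refine one_div_le_one_div_of_le ha ?_
  calc a ≤ 1 * (a + 1) := by linarith
    _ ≤ 400 * (2 * a + 1) ^ 3 * Real.cosh (a + 1 / 2) * (a + 1) := by gcongr

/-- **Honesty check: the terminal stub of the line is RH-equivalent over all cutoffs.** If the windowed off-line
second-moment law `Σ_{ρ ∈ S} m(ρ)(Re ρ - 1/2)² ≤ κ(a)` holds at every cutoff `a > 13/10` (for every height `t`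
and every finite set `S` of zeros of `ζ` with `0 ≤ Re ρ ≤ 1`, `Im ρ ≠ 0`, `|Im ρ - t| ≤ 1/a`), then the Riemann
Hypothesis holds: a zero `s` of `ζ` that is neither trivial nor `1` has `0 < Re s < 1`
(`riemannZeta_eq_zero_iff_of_re_nonpos`, `riemannZeta_ne_zero_of_one_le_re`), hence `Im s ≠ 0`
(`im_ne_zero_of_riemannZeta_eq_zero`) and `m(s) ≥ 1` (`riemannZetaZeroOrder_pos_iff`); the law at `t = Im s`,
`S = {s}` gives `(Re s - 1/2)² ≤ κ(a) ≤ 1/a` for every `a > 13/10`, so `Re s = 1/2`. [folklore] -/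
theorem stub_riemannHypothesis_of_offLineMoment :
    (∀ a : ℝ, 13 / 10 < a → ∀ (t : ℝ) (S : Finset ℂ),
      (∀ ρ ∈ S, riemannZeta ρ = 0 ∧ 0 ≤ ρ.re ∧ ρ.re ≤ 1 ∧ ρ.im ≠ 0 ∧ |ρ.im - t| ≤ 1 / a) →
      ∑ ρ ∈ S, (riemannZetaZeroOrder ρ : ℝ) * (ρ.re - 1 / 2) ^ 2 ≤
        1 / (400 * (2 * a + 1) ^ 3 * Real.cosh (a + 1 / 2) * (a + 1))) →
    RiemannHypothesis := by
  intro hlaw s hs hnt h1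
  -- the zero lies in the open critical strip, hence off the real axis, with multiplicity `≥ 1`
  have h0 : 0 < s.re := by
    by_contra hle
    exact hnt ((riemannZeta_eq_zero_iff_of_re_nonpos (not_lt.1 hle)).1 hs)
  have hlt : s.re < 1 := not_le.1 fun h => riemannZeta_ne_zero_of_one_le_re h hs
  have him : s.im ≠ 0 := im_ne_zero_of_riemannZeta_eq_zero hs h0 hlt
  have hm : (1 : ℝ) ≤ (riemannZetaZeroOrder s : ℝ) := by
    have h := (riemannZetaZeroOrder_pos_iff h1).2 hs
    have h' : (1 : ℤ) ≤ riemannZetaZeroOrder s := by omega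
    exact_mod_cast h'
  -- the law at height `t = Im s` on the singleton `S = {s}`
  have hb : ∀ a : ℝ, 13 / 10 < a → (s.re - 1 / 2) ^ 2 ≤ 1 / a := by
    intro a ha
    have ha0 : 0 < a := by linarith
    have hmem : ∀ ρ ∈ ({s} : Finset ℂ),
        riemannZeta ρ = 0 ∧ 0 ≤ ρ.re ∧ ρ.re ≤ 1 ∧ ρ.im ≠ 0 ∧ |ρ.im - s.im| ≤ 1 / a := by
      intro ρ hρ
      rw [Finset.mem_singleton] at hρ
      rw [hρ]
      refine ⟨hs, h0.le, hlt.le, him, ?_⟩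
      rw [sub_self, abs_zero]
      positivity
    have hsum := hlaw a ha s.im {s} hmem
    rw [Finset.sum_singleton] at hsum
    calc (s.re - 1 / 2) ^ 2 ≤ (riemannZetaZeroOrder s : ℝ) * (s.re - 1 / 2) ^ 2 :=
          le_mul_of_one_le_left (sq_nonneg _) hm
      _ ≤ 1 / (400 * (2 * a + 1) ^ 3 * Real.cosh (a + 1 / 2) * (a + 1)) := hsum
      _ ≤ 1 / a := offLineMomentConst_le_one_div ha0
  -- let `a → ∞`
  have hlim : Tendsto (fun a : ℝ => 1 / a) atTop (𝓝 0) := by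
    simpa only [one_div] using tendsto_inv_atTop_zero
  have hle0 : (s.re - 1 / 2) ^ 2 ≤ 0 :=
    ge_of_tendsto hlim ((eventually_gt_atTop (13 / 10 : ℝ)).mono fun a ha => hb a ha)
  have hzero : s.re - 1 / 2 = 0 :=
    (pow_eq_zero_iff two_ne_zero).1 (le_antisymm hle0 (sq_nonneg _))
  linarith

end Summit.RiemannHypothesis.RiemannHypothesis.Theorems.OscCoherentCore

end
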